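import Literature.MathematicalPhysics.QuantumFieldTheory.Balaban1983to89.B9Eq387IMSAssemblyLattice
import Literature.MathematicalPhysics.QuantumFieldTheory.Balaban1983to89.B9Eq349KWAssemblySmallField
import Literature.MathematicalPhysics.QuantumFieldTheory.Balaban1983to89.B9Eq349DPWindowsRadius

/-!
# `Balaban1983to89.B9Eq387IMSAssemblySmallField` — T. Bałaban, *Propagators for lattice gauge theories in a background field*, Commun. Math. Phys.
# **99** (1985) 389–434 [Balaban1985BackgroundPropagators] p. 408 «Σ_□ h²_□ = 1», (3.87)–(3.89) p. 409, (3.100)–(3.104) pp. 413–414, (3.26) p. 395, (3.49)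
# p. 399, Thm 3.11 p. 416: **KERNEL 7 AT THE LATTICE FOR EVERY SUFFICIENTLY FLAT BACKGROUND, ROWS L8–L9 INHABITED — there are `ε₀ > 0`, a rate
# `κ > 0` and `k ≥ 0`, fixed BEFORE the volume and the background, such that for every bond window `ε_U ≤ ε₀`, every volume, every background `U`
# (`‖U(b) − 1‖ ≤ ε_U`, `U(b) ∈ U1`, mutually adjoint transports, plaquettes `≤ δ`), every partition scale `M₀` and the tree's cut-offs, LOCAL strong
# coercivity (loc) of the form `‖D_UA‖² + ‖D*_UA‖² + a‖Q(U)A‖² − ‖(D_UP(U))†A‖²` on the cubes gives GLOBAL strong coercivity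
# `γ₁(…) + (γ₀ − C_W(δ)·k_W(M₀) − (1 − γ₁)(b₁ + b₂ + a·b₃))‖A‖² ≤ ‖D_UA‖² + ‖D*_UA‖² + a‖Q(U)A‖² − ‖(D_UP(U))†A‖²`
# with `C_W(δ) = 2(C_Ψ⁰(δ) + 2√a′)` and `k_W(M₀) = 4·(2·7^{d+1})·(4(d+1)L∕M₀)²·k·(16∕κ² + 2)·K_{d+1}(κ∕2)` EXPLICIT** — the instance theorem of
# ledger row L11 (`B9Eq387IMSAssemblyLattice.ims_assembly_strong_lattice`, gen 83) with its non-local (up) row `hWrow` DISCHARGED by row L9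
# (`B9Eq349KWAssemblySmallField.exists_kW_DP_of_small_background`, gen 85) and row L8's letter `C_W` (ne9-leaf-06's
# `B9Eq349ConjugatedDPCircleClosed.norm_DP_le_closed` under the windows of `B9Eq349DPWindowsRadius.exists_closed_windows`, gen 86); route R2′ STEP B8′ of
# the pub-balaban NE9 chain — after this file the ONLY displayed row of the L11 instance is (loc) = row L10 (`t4/ROUTES-NE9.md` v13.30–v13.44)

statement-level skeleton of published theorems with citation tags; proofs where landed; nothing here is a claim about the Yang–Mills mass gap

CITATION HEADER (lean-in-tree rule).  Audit cell `pub-balaban`, sub-cell `t4`, BINDER row NE9; filed by NE9 formalisation-swarm LEAF PROVER 01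
(`b2b-balaban-t4-ne9-formalise-leaf-01`, gen 86), composing BY NAME three landed theorems of two lineages: this lineage's `ims_assembly_strong_lattice` (gen 83;
kernel 7 of t4-ne9-idea-1 gen 92 at the lattice over ne9-leaf-04's `η`-free Leibniz letters and ne9-leaf-02's `θ_Q`-letter) and `exists_kW_DP_of_small_background`
(gen 85; road B8″ (S3a)–(S3f), (K1)–(K4b), ne9-leaf-06's flat kernels), ne9-leaf-06's `norm_DP_le_closed` (row L8's `C_W` on the diagonal), and the Mathlib-only
window radius `exists_closed_windows` (gen 86).  Source READ in the held text [Balaban1985BackgroundPropagators] (journal page = PDF page + 388): p. 408 *«We take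
the partition of unity {h_□} … Σ_{□∈𝒟} h²_□ = 1»*, p. 409 (3.87)–(3.89), p. 414 l.1–3 *«They are of the order O(M⁻¹), or O(M⁻²), if considered on a proper
scale»*, p. 395 (3.26) `DRD* = DD* − DPD*`, p. 399 (3.49), p. 416 Thm 3.11 *«for … gauge fields U in a small neighbourhood of the identity»*.  Print localises by
parametrices and random walks (p. 415); the IMS assembly and the `ε₀`-window are the ROUTE's devices (ROUTES-NE9 §L1.2 R2′ STEP B8′ S-P7, road B8″); NOTHING of
[B9] is asserted.

WHY (row L11).  `ims_assembly_strong_lattice` displays, besides the structure letters and (loc), ONE row for the non-local letter `W`: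
`hWrow : ‖WA‖² ≤ Σ_z ‖W(χ_B^zA)‖² + b_W‖A‖²`.  For `W = (D_UP(U))† = T†`, `T = D_U(1 − R(U))`, row L9 `∃ ε₀`-first gives it with `b_W = C_W·k_W(M₀)` for any
`C_W` bounding `T`, and row L8 gives `‖Tx‖ ≤ 2(C_Ψ⁰(δ) + √a′·P(ε_U))‖x‖ ≤ 2(C_Ψ⁰(δ) + 2√a′)‖x‖` once the three scalar windows hold and `P(ε_U) ≤ 2`, i.e. for
`ε_U ≤ ε₀′` of `exists_closed_windows`.  Taking `ε₀ := min(ε₀^{L9}, ε₀′)` leaves (loc) as the only displayed row.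

WHAT IS PROVED (sorry-free; proof lane — no `def`; [folklore] composition BY NAME).
* **`ims_assembly_strong_small_background`** — THE THEOREM displayed above, at torus dimension `d + 1` (the dimension letter of row L9's file), with the
  rows `b₁ = (16(d+1)(1+M_T)M_T + 8(d+1)M_T²)·64∕(M₀η)²`, `b₂ = (2(d+1)(1+M_T)M_T + (d+1)M_T²)·64∕(M₀η)²`, `b₃(ε_U)` of `ims_assembly_strong_lattice` verbatim and
  `b_W = 2(C_Ψ⁰(δ) + 2√a′)·k_W(M₀)`, `C_Ψ⁰(δ) = √(d+1)‖η⁻¹‖(M_φM_φ′)³(27∕4)^{d+1}(4∕L + 2(d(L−1))δ)`.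
HONEST SCOPE.  A junction: `ε₀, κ, k` exist by rows L9 ∕ L8 (continuity at `ε_U = 0`; NOT in closed form, NO number); (loc) = row L10 (cube-localised strong
coercivity — S-P4 ∕ S-P6′ ∕ B7′-1, other lineages) and the small-field data of `Q(U)` (`α ≤ 1∕64`, `hU1`, `hreg`) stay DISPLAYED; the local letters `T₁ = D`
(transports `R`), `T₂ = D*` (transports `S`) are kernel 7's generic ones (any transports of norm `≤ M_T`), `L ≥ 3`, `m_i ≥ 2`, diagonal `ηL = 1`,
`c₁ = L^{d+1}c₀`, ONE averaging step; the mass constant `γ₀ − b_W − (1−γ₁)Σb_i` is positive only for `M₀` large and `ε_U` small against `γ₀` — the route's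
NEEDS-CONSTANT (KAPPA1 ∕ `M₀`), not addressed.  NOT NE9 (cell pub-balaban: NE9 NOT PRINTED ∕ NOT PROVED; «NE9 ⇐ the named binders»; row WALLED ON A MODEL
(O-NE9-1; #5 UNRULED); spine PROVED 0∕9; rung (B)+1 on a finite T⁴ — NOT infinite volume, NOT mass gap, NOT BetaPertH, NOT Clay; HONEST DEPENDENCY: continuum YM
on T⁴ ⇐ BetaPertH ∧ nine spine estimates (0/9 proved); BetaPertH ⇐ (D1) ∧ (D4) ∧ CAP+tail; G-an2-4 gates asym, D1 and NE2/3/4).  NEW file importing the three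
files named; nothing modified.  Net new unproved facts: 0.
-/

noncomputable section

set_option autoImplicit false

open scoped BigOperators InnerProductSpace ComplexConjugate

namespace Literature.MathematicalPhysics.QuantumFieldTheory.Balaban1983to89.B9Eq387IMSAssemblySmallField

open B4Sect5Torus (TSite)
open B4Sect5Proof (latticeConst latticeConst_nonneg)
open B5TorusCover (Ctr)
open B5SmoothPartition (hS)
open B7Prop1Explicit (U1 Wcx boxVec)
open B9SectCLatticeCarrier (Bond bpos btgt)
open B9Eq311L2Pairing (WL2)
open B9Eq319QprimeTorus (fineP)
open B11Eq103H1Complex (SiteL2K BondL2K covDerivL2K covDivL2K)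
open B9Eq310HessianOperator (PlaqL2K covCurlL2K adTransportW)
open B9Eq310DeltaPrime (plaqHolU)
open B9Eq315QTorus (perSite perCfg cornerSite QtorusW)
open B9Eq326OperatorAssembly (RofU)
open B9Eq387IMSAssemblyLattice (ims_assembly_strong_lattice)
open B9Eq349KWAssemblySmallField (exists_kW_DP_of_small_background)
open B9Eq349ConjugatedDPCircleClosed (norm_DP_le_closed)
open B9Eq349DPWindowsRadius (exists_closed_windows)

variable {d : ℕ} (L : ℕ) [NeZero L] (hL : 1 ≤ L) (hL3 : 3 ≤ L)
  {𝔸 : Type*} [NormedRing 𝔸] [NormedAlgebra ℂ 𝔸] [NormOneClass 𝔸] [CompleteSpace 𝔸]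
  {W : Type*} [NormedAddCommGroup W] [InnerProductSpace ℂ W] [FiniteDimensional ℂ W] (φ : W ≃ₗ[ℂ] 𝔸) {Mφ Mφ' : ℝ}
  (hφ : ∀ w, ‖φ w‖ ≤ Mφ * ‖w‖) (hφ' : ∀ X, ‖φ.symm X‖ ≤ Mφ' * ‖X‖) (hMφ : 0 ≤ Mφ) (hMφ' : 0 ≤ Mφ')
  (c₀ : ℝ) [Fact (0 < c₀)] (η : ℝ) (hη : 0 < η) (c₁ : ℝ) [Fact (0 < c₁)] (hc : c₁ = (L : ℝ) ^ (d + 1) * c₀) (a' : ℝ) (ha' : 0 < a')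
  (hηL : η * L = 1)

include hL hL3 hφ hφ' hMφ hMφ' hη hc ha' hηL in
/-- **KERNEL 7 AT THE LATTICE FOR EVERY SUFFICIENTLY FLAT BACKGROUND — ROW L11 WITH ROWS L8–L9 INHABITED, `∃ ε₀ κ k` FIRST.**  Given the structure letters
(`d`, `L ≥ 3`, `η` with `ηL = 1`, `c₀`, `c₁ = L^{d+1}c₀`, `a′ > 0`, the fibre identification `φ` with `M_φ, M_φ′`), there are `ε₀ > 0`, `κ > 0`, `k ≥ 0` such
that for every volume `m` (`m_i ≥ 2`), every bond window `0 ≤ ε_U ≤ ε₀`, every background `U` (`U(b) ∈ U1`, `‖U(b) − 1‖ ≤ ε_U`, mutually adjoint transports,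
the small-field data of `Q(U)`, plaquettes `‖U(∂p) − 1‖ ≤ δ`), every `T` with the propositional let `T = D_U(1 − R(U))`, every partition scale `M₀` (`L ≤ M₀`,
`M₀ ∣ Lm_i`, `2M₀ ≤ Lm_i`) with the tree's cut-offs on sites ∕ bonds ∕ plaquettes ∕ coarse bonds, all transports `R, S` of norm `≤ M_T`, `a ≥ 0`, `γ₁ ≤ 1`:
(loc) on every cube for the form `‖D A‖² + ‖D* A‖² + a‖Q(U)A‖² − ‖T†A‖²` ⟹ the GLOBAL strong coercivity displayed in the header, `b_W = 2(C_Ψ⁰(δ) + 2√a′)·k_W(M₀)`.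
PROOF: `ims_assembly_strong_lattice` with `Wop := T†` and `hWrow` from `exists_kW_DP_of_small_background` (second conjunct) at `C_W := 2(C_Ψ⁰(δ) + 2√a′)`, which
bounds `T` by `norm_DP_le_closed` (windows from `exists_closed_windows`, `P(ε_U) ≤ 2`); `ε₀ := min` of the two radii. [folklore] (composition)
[cite: Balaban1985BackgroundPropagators, p.408 «Σ h²_□ = 1», (3.87)–(3.89) p.409, (3.100)–(3.104) pp.413–414, (3.26) p.395, (3.49) p.399, Thm 3.11 p.416] -/
theorem ims_assembly_strong_small_background :
    ∃ ε₀ κ k : ℝ, 0 < ε₀ ∧ 0 < κ ∧ 0 ≤ k ∧ ∀ (m : Fin (d + 1) → ℕ) [∀ i, NeZero (m i)] [∀ i, NeZero (fineP L m i)] (_hm : ∀ i, 2 ≤ m i)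
      (εU : ℝ) (_hεU : 0 ≤ εU) (_hεU₀ : εU ≤ ε₀)
      (U : Bond (d + 1) (fineP L m) → 𝔸ˣ) (_hU : ∀ b, U b ∈ U1 𝔸) (_hUε : ∀ b, ‖(U b : 𝔸) - 1‖ ≤ εU)
      (_hRS : ∀ (b : Bond (d + 1) (fineP L m)) (v u : W), ⟪adTransportW φ U b v, u⟫_ℂ = ⟪v, adTransportW φ (fun b => (U b)⁻¹) b u⟫_ℂ)
      {α : ℝ} (hα1 : α ≤ 1 / 64) (hU1 : ∀ (x : B7Prop1Explicit.Site (d + 1)) (κ' : Fin (d + 1)), perCfg (fineP L m) U x κ' ∈ U1 𝔸)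
      (hreg : ∀ (y : TSite (d + 1) m) (κ' : Fin (d + 1)) (r : Fin (d + 1) → Fin L),
        ‖((Wcx L (perCfg (fineP L m) U) (cornerSite L y) κ' (boxVec L r) : 𝔸ˣ) : 𝔸) - 1‖ ≤ α)
      {δ : ℝ} (_hδ0 : 0 ≤ δ) (_hδ : ∀ p : B9SectCLatticeCarrier.Plaq (d + 1) (fineP L m), ‖(plaqHolU U p : 𝔸) - 1‖ ≤ δ)
      (T : SiteL2K ℂ (d + 1) (fineP L m) c₀ W →L[ℂ] BondL2K ℂ (d + 1) (fineP L m) c₀ W)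
      (_hT : T = LinearMap.toContinuousLinearMap (covDerivL2K ℂ c₀ ((η : ℂ))⁻¹ (adTransportW φ U) ∘ₗ (LinearMap.id - RofU L m φ η U (c₀ := c₀))))
      (M₀ : ℕ) (_hM : 1 ≤ M₀) (_hLM : L ≤ M₀) (_hdiv : ∀ i, M₀ ∣ fineP L m i) (_h2N : ∀ i, 2 * M₀ ≤ fineP L m i)
      (χS : Ctr (fineP L m) M₀ → SiteL2K ℂ (d + 1) (fineP L m) c₀ W →L[ℂ] SiteL2K ℂ (d + 1) (fineP L m) c₀ W)
      (χB : Ctr (fineP L m) M₀ → BondL2K ℂ (d + 1) (fineP L m) c₀ W →L[ℂ] BondL2K ℂ (d + 1) (fineP L m) c₀ W)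
      (χP : Ctr (fineP L m) M₀ → PlaqL2K ℂ (d + 1) (fineP L m) c₀ W →L[ℂ] PlaqL2K ℂ (d + 1) (fineP L m) c₀ W)
      (χC : Ctr (fineP L m) M₀ → BondL2K ℂ (d + 1) m c₁ W →L[ℂ] BondL2K ℂ (d + 1) m c₁ W)
      (_hχS : ∀ (z : Ctr (fineP L m) M₀) (f : SiteL2K ℂ (d + 1) (fineP L m) c₀ W) (x : TSite (d + 1) (fineP L m)),
        WL2.equiv ℂ (fun _ : TSite (d + 1) (fineP L m) => c₀) W (χS z f) x =
          (hS (fineP L m) M₀ z x : ℂ) • WL2.equiv ℂ (fun _ : TSite (d + 1) (fineP L m) => c₀) W f x)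
      (_hχB : ∀ (z : Ctr (fineP L m) M₀) (g : BondL2K ℂ (d + 1) (fineP L m) c₀ W) (b : Bond (d + 1) (fineP L m)),
        WL2.equiv ℂ (fun _ : Bond (d + 1) (fineP L m) => c₀) W (χB z g) b =
          (hS (fineP L m) M₀ z (bpos b) : ℂ) • WL2.equiv ℂ (fun _ : Bond (d + 1) (fineP L m) => c₀) W g b)
      (_hχP : ∀ (z : Ctr (fineP L m) M₀) (G : PlaqL2K ℂ (d + 1) (fineP L m) c₀ W) (p : B9SectCLatticeCarrier.Plaq (d + 1) (fineP L m)),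
        WL2.equiv ℂ (fun _ : B9SectCLatticeCarrier.Plaq (d + 1) (fineP L m) => c₀) W (χP z G) p =
          (hS (fineP L m) M₀ z p.1 : ℂ) • WL2.equiv ℂ (fun _ : B9SectCLatticeCarrier.Plaq (d + 1) (fineP L m) => c₀) W G p)
      (_hχC : ∀ (z : Ctr (fineP L m) M₀) (g : BondL2K ℂ (d + 1) m c₁ W) (c : Bond (d + 1) m),
        WL2.equiv ℂ (fun _ : Bond (d + 1) m => c₁) W (χC z g) c =
          (hS (fineP L m) M₀ z (perSite (fineP L m) (cornerSite L c.1)) : ℂ) • WL2.equiv ℂ (fun _ : Bond (d + 1) m => c₁) W g c)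
      {R S : Bond (d + 1) (fineP L m) → W →ₗ[ℂ] W} {MT : ℝ} (_hMT : 0 ≤ MT) (_hR : ∀ b v, ‖R b v‖ ≤ MT * ‖v‖) (_hS' : ∀ b v, ‖S b v‖ ≤ MT * ‖v‖)
      {a : ℝ} (_ha : 0 ≤ a) {γ₁ γ₀ : ℝ} (_hγ₁ : γ₁ ≤ 1)
      (_hloc : ∀ (z : Ctr (fineP L m) M₀) (A : BondL2K ℂ (d + 1) (fineP L m) c₀ W),
        γ₁ * (‖covCurlL2K ℂ c₀ ((η : ℂ))⁻¹ R (χB z A)‖ ^ 2 + ‖covDivL2K ℂ c₀ ((η : ℂ))⁻¹ S (χB z A)‖ ^ 2 +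
            ‖((Real.sqrt a : ℝ) : ℂ) • QtorusW L m hL φ U hα1 hU1 hreg (c₁ := c₁) (χB z A)‖ ^ 2) + γ₀ * ‖χB z A‖ ^ 2 ≤
          (‖covCurlL2K ℂ c₀ ((η : ℂ))⁻¹ R (χB z A)‖ ^ 2 + ‖covDivL2K ℂ c₀ ((η : ℂ))⁻¹ S (χB z A)‖ ^ 2 +
            ‖((Real.sqrt a : ℝ) : ℂ) • QtorusW L m hL φ U hα1 hU1 hreg (c₁ := c₁) (χB z A)‖ ^ 2) - ‖ContinuousLinearMap.adjoint T (χB z A)‖ ^ 2)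
      (A : BondL2K ℂ (d + 1) (fineP L m) c₀ W),
      γ₁ * (‖covCurlL2K ℂ c₀ ((η : ℂ))⁻¹ R A‖ ^ 2 + ‖covDivL2K ℂ c₀ ((η : ℂ))⁻¹ S A‖ ^ 2 +
            ‖((Real.sqrt a : ℝ) : ℂ) • QtorusW L m hL φ U hα1 hU1 hreg (c₁ := c₁) A‖ ^ 2) +
          (γ₀ -
              (2 * (Real.sqrt ((d + 1 : ℕ) : ℝ) * (‖((η : ℂ))⁻¹‖ * (Mφ * Mφ') ^ 3 *
                  (((27 : ℝ) / 4) ^ (d + 1) * (4 / (L : ℝ) + 2 * (((((d + 1 : ℕ) : ℝ) - 1) * ((L : ℝ) - 1)) * δ)))) + Real.sqrt a' * 2)) *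
                (4 * ((2 * 7 ^ (d + 1) : ℕ) : ℝ) *
                  ((4 * ((d + 1 : ℕ) : ℝ) * L / M₀) ^ 2 * k * ((16 / κ ^ 2 + 2) * latticeConst (d + 1) (κ / 2)))) -
              (1 - γ₁) *
                ((16 * ((d + 1 : ℕ) : ℝ) * ((1 + MT) * MT * (64 * ((M₀ : ℝ) * η)⁻¹ ^ 2)) +
                      8 * ((d + 1 : ℕ) : ℝ) * MT ^ 2 * (64 * ((M₀ : ℝ) * η)⁻¹ ^ 2)) +
                  (2 * ((d + 1 : ℕ) : ℝ) * ((1 + MT) * MT * (64 * ((M₀ : ℝ) * η)⁻¹ ^ 2)) +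
                      ((d + 1 : ℕ) : ℝ) * MT ^ 2 * (64 * ((M₀ : ℝ) * η)⁻¹ ^ 2)) +
                  a * ((Real.sqrt (c₁ / (c₀ * (L : ℝ) ^ (d + 1))) +
                        Mφ' * Mφ * Real.sqrt (2 * ((d + 1 : ℕ) : ℝ) * c₁ / c₀) * (102 * (((d + 1 : ℕ) : ℝ) + 1) ^ 2 * L * εU)) *
                      (256 * ((d + 1 : ℕ) : ℝ) * ((L : ℝ) - 1) ^ 2 / (M₀ : ℝ) ^ 2 * Real.sqrt (c₁ / (c₀ * (L : ℝ) ^ (d + 1))) +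
                        4 * (Mφ' * Mφ * Real.sqrt (2 * ((d + 1 : ℕ) : ℝ) * c₁ / c₀) * (102 * (((d + 1 : ℕ) : ℝ) + 1) ^ 2 * L * εU))) +
                    (2 * (256 * ((d + 1 : ℕ) : ℝ) * ((L : ℝ) - 1) ^ 2 / (M₀ : ℝ) ^ 2 * (c₁ / (c₀ * (L : ℝ) ^ (d + 1)))) +
                      8 * (Mφ' * Mφ * Real.sqrt (2 * ((d + 1 : ℕ) : ℝ) * c₁ / c₀) * (102 * (((d + 1 : ℕ) : ℝ) + 1) ^ 2 * L * εU)) ^ 2)))) *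
            ‖A‖ ^ 2 ≤
        (‖covCurlL2K ℂ c₀ ((η : ℂ))⁻¹ R A‖ ^ 2 + ‖covDivL2K ℂ c₀ ((η : ℂ))⁻¹ S A‖ ^ 2 +
            ‖((Real.sqrt a : ℝ) : ℂ) • QtorusW L m hL φ U hα1 hU1 hreg (c₁ := c₁) A‖ ^ 2) - ‖ContinuousLinearMap.adjoint T A‖ ^ 2 := by
  have hc₀ : 0 < c₀ := Fact.out
  have hc₁ : 0 < c₁ := Fact.out
  have hL' : (3 : ℝ) ≤ (L : ℝ) := by exact_mod_cast hL3
  -- row L9, `∃ ε₀`-first (gen 85)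
  obtain ⟨ε₁, κ, k, hε₁, hκ, hk, H9⟩ :=
    exists_kW_DP_of_small_background (d := d) L φ hφ hφ' hMφ hMφ' c₀ η hη c₁ hc a' ha' hηL
  -- row L8's scalar windows on a whole interval (gen 86, Mathlib-only)
  obtain ⟨ε₂, hε₂, _hε₂1, H8⟩ := exists_closed_windows (d + 1) L hL3 ha' hMφ hMφ' hc₀ hc₁ ‖((η : ℂ))⁻¹‖
  refine ⟨min ε₁ ε₂, κ, k, lt_min hε₁ hε₂, hκ, hk, ?_⟩
  intro m _ _ hm εU hεU hεU₀ U hU hUε hRS α hα1 hU1 hreg δ hδ0 hδ T hT M₀ hM hLM hdiv h2N χS χB χP χC hχS hχB hχP hχC R S MT hMT hR hS'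
    a ha γ₁ γ₀ hγ₁ hloc A
  -- the background sits in both windows
  have hUε₁ : ∀ b, ‖(U b : 𝔸) - 1‖ ≤ ε₁ := fun b => (hUε b).trans (hεU₀.trans (min_le_left _ _))
  have hεU₂ : εU ≤ ε₂ := hεU₀.trans (min_le_right _ _)
  -- row L9 at this background: the (up) row of `W = T†` for any `C_W` bounding `T`
  obtain ⟨_, Hup⟩ := H9 m U hU hUε₁ hRS T hT M₀ hM hLM h2N χS χB hχS hχB
  -- row L8: `‖Tx‖ ≤ 2(C_Ψ⁰(δ) + √a′·P(ε_U))‖x‖ ≤ 2(C_Ψ⁰(δ) + 2√a′)‖x‖`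
  obtain ⟨hP2, γ, κ₁, hγ, hγ1, hκ₁, hγc, hwinU, hκU⟩ := H8 εU hεU hεU₂
  have hd1 : 1 ≤ d + 1 := by omega
  have hdR : (0 : ℝ) ≤ ((d + 1 : ℕ) : ℝ) - 1 := by push_cast; linarith [Nat.cast_nonneg (α := ℝ) d]
  have hLR : (0 : ℝ) ≤ (L : ℝ) - 1 := by linarith
  have hCΨ : 0 ≤ Real.sqrt ((d + 1 : ℕ) : ℝ) * (‖((η : ℂ))⁻¹‖ * (Mφ * Mφ') ^ 3 *
      (((27 : ℝ) / 4) ^ (d + 1) * (4 / (L : ℝ) + 2 * (((((d + 1 : ℕ) : ℝ) - 1) * ((L : ℝ) - 1)) * δ)))) := by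
    have h1 : 0 ≤ ((((d + 1 : ℕ) : ℝ) - 1) * ((L : ℝ) - 1)) * δ := mul_nonneg (mul_nonneg hdR hLR) hδ0
    have h2 : (0 : ℝ) ≤ 4 / (L : ℝ) := by positivity
    have h3 : 0 ≤ Mφ * Mφ' := mul_nonneg hMφ hMφ'
    positivity
  have hCW0 : 0 ≤ 2 * (Real.sqrt ((d + 1 : ℕ) : ℝ) * (‖((η : ℂ))⁻¹‖ * (Mφ * Mφ') ^ 3 *
      (((27 : ℝ) / 4) ^ (d + 1) * (4 / (L : ℝ) + 2 * (((((d + 1 : ℕ) : ℝ) - 1) * ((L : ℝ) - 1)) * δ)))) + Real.sqrt a' * 2) := by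
    positivity
  have hTW : ∀ x : SiteL2K ℂ (d + 1) (fineP L m) c₀ W, ‖T x‖ ≤
      2 * (Real.sqrt ((d + 1 : ℕ) : ℝ) * (‖((η : ℂ))⁻¹‖ * (Mφ * Mφ') ^ 3 *
        (((27 : ℝ) / 4) ^ (d + 1) * (4 / (L : ℝ) + 2 * (((((d + 1 : ℕ) : ℝ) - 1) * ((L : ℝ) - 1)) * δ)))) + Real.sqrt a' * 2) * ‖x‖ := by
    intro x
    have h := norm_DP_le_closed (d := d + 1) hφ hφ' hMφ hMφ' hη hU hεU hUε hc ha' hRS hηL hγ hγ1 hκ₁ hγc hwinU hκU hd1 hL3 hm hδ0 hδ x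
    have hTx : T x = covDerivL2K ℂ c₀ ((η : ℂ))⁻¹ (adTransportW φ U) (x - RofU L m φ η U (c₀ := c₀) x) := by
      rw [hT]
      simp only [LinearMap.coe_toContinuousLinearMap', LinearMap.comp_apply, LinearMap.sub_apply, LinearMap.id_apply]
    rw [hTx]
    refine h.trans ?_
    have hsa : 0 ≤ Real.sqrt a' := Real.sqrt_nonneg _
    have hx : 0 ≤ ‖x‖ := norm_nonneg _
    have hPa : Real.sqrt a' * (1 + 2 * Mφ * Mφ' * εU) ^ ((d + 1) * (L - 1)) ≤ Real.sqrt a' * 2 := mul_le_mul_of_nonneg_left hP2 hsa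
    exact mul_le_mul_of_nonneg_right (mul_le_mul_of_nonneg_left (add_le_add le_rfl hPa) (by norm_num)) hx
  -- the (up) row of `T†` with this `C_W`
  have hWrow := fun g => Hup hdiv hCW0 hTW g
  -- kernel 7 at the lattice (gen 83) with `Wop := T†`
  exact ims_assembly_strong_lattice L m hL U hα1 hU1 hreg φ hεU hUε hMφ hφ hMφ' hφ' hM hdiv h2N χB χP χS χC hχB hχP hχS hχC hη hMT hR hS'
    ha (ContinuousLinearMap.adjoint T) hWrow hγ₁ hloc A

end Literature.MathematicalPhysics.QuantumFieldTheory.Balaban1983to89.B9Eq387IMSAssemblySmallField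

end
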